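import Literature.Analysis.FunctionSpaces.LorentzGas
import HarnessLib

/-!
# Discharged fact: conservation of speed along a Lorentz-gas trajectory

`Literature.Analysis.FunctionSpaces.LorentzGas` records as a named fact
`Literature.Analysis.FunctionSpaces.IsLorentzTrajectory.norm_snd_eq` that the speed `‖v(t)‖` is constant along a
Lorentz-gas trajectory `γ = (x, v)` among fixed hard-ball scatterers (Spohn, Comm. Math. Phys.
60 (1978): §1, p. 277 — specular reflection at the hard cores; p. 283 "by conservation of
energy `|p| = |p'|`"; p. 287 "for hard sphere scatterers (`a = R`) `|p|` is conserved"; p. 288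
"the speed is conserved"). It is proved here, `IsLorentzTrajectory.norm_snd_eq_holds`, exactly
along the printed mechanism:

* `norm_specularReflect` — the specular reflection `specularReflect n = ((ℝ ∙ n)ᗮ).reflection`
  is a linear isometry (Mathlib `LinearIsometryEquiv.norm_map`);
* `IsLorentzTrajectory.snd_eq_of_forall_notMem` — on a reflection-free interval `(s, t]` the
  velocity is constant (field `free`);
* `IsLorentzTrajectory.norm_snd_eq_of_mem_collisionTimes` — at a reflection time `τ` preceded
  by a reflection-free `(u, τ)` the incoming (left-limit) velocity is `v(u)` (the velocity is
  eventually constant on `𝓝[<] τ`, `tendsto_nhds_unique`) and `v(τ)` is its reflection, so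
  `‖v(τ)‖ = ‖v(u)‖` (field `reflect`);
* `IsLorentzTrajectory.norm_snd_eq_of_le` — induction on the number of reflection times in
  `(s, t]`, finite by the field `locFinite`, peeling off the first one;
* `IsLorentzTrajectory.norm_snd_eq_holds` — symmetrise in `s, t`.

No hypothesis on `ε` is needed (the reflection is an isometry for every normal vector, and the
identity for `n = 0`).

## References

* H. Spohn, *The Lorentz process converges to a random flight process*, Comm. Math. Phys. 60
  (1978) 277–290, §1 and p. 287. [Spohn1978]
-/

open MeasureTheory Metric Real Set Filter Topology
open scoped InnerProductSpace ENNReal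

namespace Literature.Analysis.FunctionSpaces

noncomputable section

section SpeedConservation

variable {d : Type*} [Fintype d]

/-- The specular reflection is an isometry: `‖specularReflect n v‖ = ‖v‖` (it is Mathlib's
orthogonal reflection `Submodule.reflection`, a `LinearIsometryEquiv`; Spohn CMP 60 (1978)
p. 283: "by conservation of energy `|p| = |p'|`"). [folklore] -/
@[simp]
theorem norm_specularReflect (n v : EuclideanSpace ℝ d) : ‖specularReflect n v‖ = ‖v‖ :=
  LinearIsometryEquiv.norm_map _ _

namespace IsLorentzTrajectory

variable {ε : ℝ} {c : PointConfig (EuclideanSpace ℝ d)}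
  {γ : ℝ → EuclideanSpace ℝ d × EuclideanSpace ℝ d}

/-- On a reflection-free interval `(s, t]` the velocity is constant (free flight). [folklore] -/
theorem snd_eq_of_forall_notMem (h : IsLorentzTrajectory ε c γ) {s t : ℝ} (hst : s ≤ t)
    (hfree : ∀ τ ∈ Ioc s t, τ ∉ lorentzCollisionTimes ε c γ) : (γ t).2 = (γ s).2 := by
  rw [h.free s t hst hfree]

/-- At a reflection time `τ` preceded by a reflection-free interval `(u, τ)`, `u < τ`, the incoming
velocity (left limit) is `v(u)` and the outgoing one is its specular reflection, so
`‖v(τ)‖ = ‖v(u)‖`. [folklore] -/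
theorem norm_snd_eq_of_mem_collisionTimes (h : IsLorentzTrajectory ε c γ) {u τ : ℝ} (huτ : u < τ)
    (hτ : τ ∈ lorentzCollisionTimes ε c γ)
    (hfree : ∀ σ ∈ Ioo u τ, σ ∉ lorentzCollisionTimes ε c γ) : ‖(γ τ).2‖ = ‖(γ u).2‖ := by
  obtain ⟨a, ha, hτa⟩ := hτ
  obtain ⟨-, vl, hvl, -, hout⟩ := h.reflect τ a ha hτa
  have hconst : (fun _ => (γ u).2) =ᶠ[𝓝[<] τ] fun σ => (γ σ).2 := by
    filter_upwards [Ioo_mem_nhdsLT huτ] with σ hσ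
    exact (h.snd_eq_of_forall_notMem hσ.1.le
      fun ρ hρ => hfree ρ ⟨hρ.1, hρ.2.trans_lt hσ.2⟩).symm
  have hlim : Tendsto (fun σ => (γ σ).2) (𝓝[<] τ) (𝓝 (γ u).2) :=
    tendsto_const_nhds.congr' hconst
  rw [hout, norm_specularReflect, tendsto_nhds_unique hvl hlim]

/-- Conservation of speed forward in time: `‖v(t)‖ = ‖v(s)‖` for `s ≤ t`, by induction on the
(finite) number of reflection times in `(s, t]`. [folklore] -/
theorem norm_snd_eq_of_le (h : IsLorentzTrajectory ε c γ) {s t : ℝ} (hst : s ≤ t) :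
    ‖(γ t).2‖ = ‖(γ s).2‖ := by
  suffices H : ∀ (n : ℕ) (s : ℝ), s ≤ t →
      (lorentzCollisionTimes ε c γ ∩ Ioc s t).ncard ≤ n → ‖(γ t).2‖ = ‖(γ s).2‖ from
    H _ s hst le_rfl
  intro n
  induction n with
  | zero =>
    intro s hst hn
    have hfin : (lorentzCollisionTimes ε c γ ∩ Ioc s t).Finite :=
      (h.locFinite s t).subset (inter_subset_inter_right _ Ioc_subset_Icc_self)
    have hempty : lorentzCollisionTimes ε c γ ∩ Ioc s t = ∅ :=
      (Set.ncard_eq_zero hfin).1 (Nat.le_zero.1 hn)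
    rw [h.snd_eq_of_forall_notMem hst fun τ hτ hτC => ?_]
    have hmem : τ ∈ lorentzCollisionTimes ε c γ ∩ Ioc s t := ⟨hτC, hτ⟩
    rw [hempty] at hmem
    exact hmem
  | succ n ih =>
    intro s hst hn
    set C := lorentzCollisionTimes ε c γ ∩ Ioc s t with hC
    have hfin : C.Finite :=
      (h.locFinite s t).subset (inter_subset_inter_right _ Ioc_subset_Icc_self)
    rcases C.eq_empty_or_nonempty with hCe | hCne
    · rw [h.snd_eq_of_forall_notMem hst fun τ hτ hτC => ?_]
      have hmem : τ ∈ C := ⟨hτC, hτ⟩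
      rw [hCe] at hmem
      exact hmem
    · -- peel off the first reflection time `τ ∈ (s, t]`
      obtain ⟨τ, hτC, hτmin⟩ := Set.exists_min_image C id hfin hCne
      have hsτ : s < τ := hτC.2.1
      have hτt : τ ≤ t := hτC.2.2
      -- `(s, τ)` is reflection-free
      have hfree : ∀ σ ∈ Ioo s τ, σ ∉ lorentzCollisionTimes ε c γ := fun σ hσ hσC =>
        (show τ ≤ σ from hτmin σ ⟨hσC, hσ.1, hσ.2.le.trans hτt⟩).not_gt hσ.2
      have h1 : ‖(γ τ).2‖ = ‖(γ s).2‖ := h.norm_snd_eq_of_mem_collisionTimes hsτ hτC.1 hfree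
      -- the remaining reflection times in `(τ, t]` are `C \ {τ}`, one fewer
      have hsub : lorentzCollisionTimes ε c γ ∩ Ioc τ t ⊆ C \ {τ} := fun σ hσ =>
        ⟨⟨hσ.1, hsτ.trans hσ.2.1, hσ.2.2⟩, fun hστ => (lt_irrefl σ) (by
          rw [mem_singleton_iff] at hστ; exact hστ ▸ hσ.2.1)⟩
      have hcard : (lorentzCollisionTimes ε c γ ∩ Ioc τ t).ncard ≤ n := by
        refine (Set.ncard_le_ncard hsub hfin.sdiff).trans ?_
        rw [Set.ncard_sdiff_singleton_of_mem hτC]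
        omega
      rw [ih τ hτt hcard, h1]

/-- **Conservation of speed along a Lorentz trajectory** (discharge of the named fact
`norm_snd_eq`): free flight keeps the velocity, and at each of the locally finitely many
reflection times the outgoing velocity is the specular reflection — a linear isometry — of the
incoming one (Spohn, Comm. Math. Phys. 60 (1978): §1 (specular reflection at hard cores),
p. 283 "by conservation of energy `|p| = |p'|`", p. 287 "for hard sphere scatterers `|p|` is
conserved", p. 288 "the speed is conserved"). [cite: Spohn1978, §1, p. 287] -/
theorem norm_snd_eq_holds : norm_snd_eq (ε := ε) (c := c) (γ := γ) := by
  intro h s t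
  rcases le_total s t with hst | hts
  · exact (h.norm_snd_eq_of_le hst).symm
  · exact h.norm_snd_eq_of_le hts

end IsLorentzTrajectory

end SpeedConservation

end

end Literature.Analysis.FunctionSpaces
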